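import Mathlib

/-!
# Hidden corner lemma: the E-side defect bound (Theorem 1)

Setting: a pencil `T(X) = ∑ a b, X a b • T a b` of `N × N` complex matrices, the lower shift
`Z`, tall matrices `E F : N × r` with left inverses `ΛE`, `ΛF`, the corner relation
`T(X) E = F X`, and Stein displacement rank `rank (T(X) - Z T(X) Zᵀ) ≤ d` for every `X`.
Assume the shift-compression `A₁ := ΛF Z F` is nilpotent.  Then

`r ≤ d + rank ((1 - E ΛE) Zᵀ E)`.

Proof.  Put `B₁ := ΛE Zᵀ E`, `K := (1 - E ΛE) Zᵀ E`, `D(X) := T(X) - Z T(X) Zᵀ`.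
* Algebra (`hclR_dbE_identity`): since `ΛF F = 1` and `T(X) E = F X`, and `Zᵀ E = E B₁ + K`,
  `X - A₁ X B₁ = ΛF D(X) E + ΛF Z T(X) K` for every `X`.
* Ranks (`hclR_dbE_rank_key`): hence `rank (X - A₁ X B₁) ≤ rank D(X) + rank K ≤ d + rank K`.
* Telescoping (`hclR_dbE_stein_telescope`): if `A₁ ^ k = 0`, then
  `X₀ := ∑_{i<k} A₁^i B₁^i` satisfies `X₀ - A₁ X₀ B₁ = A₁^0 B₁^0 - A₁^k B₁^k = 1`.
* So `r = rank 1 ≤ d + rank K`.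
The hypothesis `ΛE E = 1` is part of the common interface of the two defect bounds but is not
needed for this one.
-/

set_option linter.dupNamespace false

namespace Summit.MatrixMultiplication.MatrixMultiplication.Theorems

open scoped Matrix

/-- Sub-additivity of matrix rank over `ℂ`: `rank (A + B) ≤ rank A + rank B`. -/
private lemma hclR_dbE_rank_add_le {m n : Type*} [Fintype m] [Fintype n]
    (A B : Matrix m n ℂ) : (A + B).rank ≤ A.rank + B.rank := by
  unfold Matrix.rank
  rw [Matrix.mulVecLin_add]
  exact (Submodule.finrank_mono (LinearMap.range_add_le _ _)).trans
    (Submodule.finrank_add_le_finrank_add_finrank _ _)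

/-- The corner-adapted `(1,1)`-block identity: with `ΛF * F = 1` and `TX * E = F * X`,
`X - (ΛF Z F) X (ΛE W E) = ΛF (TX - Z TX W) E + ΛF Z TX ((1 - E ΛE) W E)`. -/
private lemma hclR_dbE_identity {r N : ℕ} (TX Z W : Matrix (Fin N) (Fin N) ℂ)
    (E F : Matrix (Fin N) (Fin r) ℂ) (ΛE ΛF : Matrix (Fin r) (Fin N) ℂ) (hΛF : ΛF * F = 1)
    (X : Matrix (Fin r) (Fin r) ℂ) (hE : TX * E = F * X) :
    X - ΛF * Z * F * X * (ΛE * W * E) =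
      ΛF * (TX - Z * TX * W) * E + ΛF * Z * TX * ((1 - E * ΛE) * W * E) := by
  have h1 : ΛF * (TX * E) = X := by
    rw [hE, ← Matrix.mul_assoc, hΛF, Matrix.one_mul]
  simp only [Matrix.mul_sub, Matrix.sub_mul, Matrix.one_mul, Matrix.mul_assoc]
  rw [h1, ← Matrix.mul_assoc TX E, hE, Matrix.mul_assoc F X]
  abel

/-- Rank consequence of the block identity:
`rank (X - (ΛF Z F) X (ΛE W E)) ≤ d + rank ((1 - E ΛE) W E)` whenever
`rank (TX - Z TX W) ≤ d`. -/
private lemma hclR_dbE_rank_key {r N d : ℕ} (TX Z W : Matrix (Fin N) (Fin N) ℂ)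
    (E F : Matrix (Fin N) (Fin r) ℂ) (ΛE ΛF : Matrix (Fin r) (Fin N) ℂ) (hΛF : ΛF * F = 1)
    (X : Matrix (Fin r) (Fin r) ℂ) (hE : TX * E = F * X) (hD : (TX - Z * TX * W).rank ≤ d) :
    (X - ΛF * Z * F * X * (ΛE * W * E)).rank ≤ d + ((1 - E * ΛE) * W * E).rank := by
  rw [hclR_dbE_identity TX Z W E F ΛE ΛF hΛF X hE]
  calc (ΛF * (TX - Z * TX * W) * E + ΛF * Z * TX * ((1 - E * ΛE) * W * E)).rank
      ≤ (ΛF * (TX - Z * TX * W) * E).rank + (ΛF * Z * TX * ((1 - E * ΛE) * W * E)).rank :=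
        hclR_dbE_rank_add_le _ _
    _ ≤ (TX - Z * TX * W).rank + ((1 - E * ΛE) * W * E).rank :=
        add_le_add ((Matrix.rank_mul_le_left _ _).trans (Matrix.rank_mul_le_right _ _))
          (Matrix.rank_mul_le_right _ _)
    _ ≤ d + ((1 - E * ΛE) * W * E).rank := Nat.add_le_add_right hD _

/-- Telescoping for the Stein operator `X ↦ X - A X B`: if `A ^ k = 0` then
`X₀ := ∑_{i<k} A^i B^i` solves `X₀ - A X₀ B = 1`. -/
private lemma hclR_dbE_stein_telescope {r : ℕ} (A B : Matrix (Fin r) (Fin r) ℂ) {k : ℕ}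
    (hk : A ^ k = 0) :
    (∑ i ∈ Finset.range k, A ^ i * B ^ i) - A * (∑ i ∈ Finset.range k, A ^ i * B ^ i) * B
      = 1 := by
  rw [Finset.mul_sum, Finset.sum_mul, ← Finset.sum_sub_distrib]
  have h : ∀ i ∈ Finset.range k,
      A ^ i * B ^ i - A * (A ^ i * B ^ i) * B = A ^ i * B ^ i - A ^ (i + 1) * B ^ (i + 1) := by
    intro i _
    rw [pow_succ' A i, pow_succ B i]
    simp only [Matrix.mul_assoc]
  rw [Finset.sum_congr rfl h, Finset.sum_range_sub' (fun i => A ^ i * B ^ i) k]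
  simp [hk]

/-- Abstract form of the E-side defect bound, with the pencil `Tm` and the shift `Z` opaque. -/
private lemma hclR_dbE_main {r N d : ℕ}
    (Tm : Matrix (Fin r) (Fin r) ℂ → Matrix (Fin N) (Fin N) ℂ) (Z : Matrix (Fin N) (Fin N) ℂ)
    (E F : Matrix (Fin N) (Fin r) ℂ) (ΛE ΛF : Matrix (Fin r) (Fin N) ℂ) (hΛF : ΛF * F = 1)
    (hnil : IsNilpotent (ΛF * Z * F))
    (hcorner : ∀ X : Matrix (Fin r) (Fin r) ℂ, Tm X * E = F * X)
    (hdisp : ∀ X : Matrix (Fin r) (Fin r) ℂ, (Tm X - Z * Tm X * Zᵀ).rank ≤ d) :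
    r ≤ d + ((1 - E * ΛE) * Zᵀ * E).rank := by
  obtain ⟨k, hk⟩ := hnil
  have key := hclR_dbE_rank_key (Tm (∑ i ∈ Finset.range k, (ΛF * Z * F) ^ i * (ΛE * Zᵀ * E) ^ i))
    Z Zᵀ E F ΛE ΛF hΛF (∑ i ∈ Finset.range k, (ΛF * Z * F) ^ i * (ΛE * Zᵀ * E) ^ i)
    (hcorner _) (hdisp _)
  rw [hclR_dbE_stein_telescope _ _ hk, Matrix.rank_one, Fintype.card_fin] at key
  exact key

/-- E-side defect bound (Theorem 1 of the corner-adapted analysis; no nonsingularity needed):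
with a left inverse `ΛE` of `E`, a left inverse `ΛF` of `F` whose shift-compression `ΛF Z F` is
nilpotent, the corner relation and displacement rank ≤ d give `r ≤ d + rank ((1 − E ΛE) Zᵀ E)`. -/
theorem hclR_defect_bound_E (r N d : ℕ) (T : Fin r → Fin r → Matrix (Fin N) (Fin N) ℂ)
    (E F : Matrix (Fin N) (Fin r) ℂ)
    (ΛE : Matrix (Fin r) (Fin N) ℂ) (hΛE : ΛE * E = 1)
    (ΛF : Matrix (Fin r) (Fin N) ℂ) (hΛF : ΛF * F = 1)
    (hnil : IsNilpotent (ΛF * (Matrix.of fun i j : Fin N => if (i : ℕ) = (j : ℕ) + 1 then (1 : ℂ) else 0) * F))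
    (hcorner : ∀ X : Matrix (Fin r) (Fin r) ℂ, (∑ a : Fin r, ∑ b : Fin r, X a b • T a b) * E = F * X)
    (hdisp : ∀ X : Matrix (Fin r) (Fin r) ℂ, ((∑ a : Fin r, ∑ b : Fin r, X a b • T a b) -
        (Matrix.of fun i j : Fin N => if (i : ℕ) = (j : ℕ) + 1 then (1 : ℂ) else 0) *
        (∑ a : Fin r, ∑ b : Fin r, X a b • T a b) *
        (Matrix.of fun i j : Fin N => if (i : ℕ) = (j : ℕ) + 1 then (1 : ℂ) else 0)ᵀ).rank ≤ d) :
    r ≤ d + ((1 - E * ΛE) * (Matrix.of fun i j : Fin N => if (i : ℕ) = (j : ℕ) + 1 then (1 : ℂ) else 0)ᵀ * E).rank := by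
  -- `hΛE` belongs to the shared interface of the two defect bounds; this bound does not use it.
  have _ := hΛE
  exact hclR_dbE_main (fun X => ∑ a : Fin r, ∑ b : Fin r, X a b • T a b) _ E F ΛE ΛF hΛF hnil
    hcorner hdisp

end Summit.MatrixMultiplication.MatrixMultiplication.Theorems
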